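import Literature.AlgebraicGeometry.Frobenioids.FSMIMorphisms
import Literature.AlgebraicGeometry.Frobenioids.EquivalencePreStepsFSMFF2024
import HarnessLib

/-!
# Frobenioids I, §0 (pp. 14, 17–18): FSM- / FSMI-morphisms, chains of FSMI-morphisms and the two
# notions "of FSMFF-type" (2008; Comments 2024 (28)) under equivalences of categories

Mochizuki, *The geometry of Frobenioids I: the general theory*, Kyushu J. Math. **62** (2008)
293–400, §0 "Categories", kurims text p. 14 (FSM-morphisms), pp. 17–18 ("FSMI-morphisms",
"of FSMFF-type") [cite: MochizukiFrdI2008, §0 pp.17-18]; author's *Comments* (2024) item (28), p. 3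
(revised condition (b)) [cite: MochizukiFrdIComments2024, (28) p.3].  Typed in
`CategoriesFactorization.lean` (`IsFSMI`, `IsFSMIChain`, `IsOfFSMFFType`, abc-iut-L1-t1) and
`CategoriesFactorizationRevised.lean` (`IsHeadedFSMIChain`, `IsOfFSMFFType2024`).

`EquivalenceTransport.lean` proves that an equivalence `e` PRESERVES FSM- and FSMI-morphisms ("any
equivalence of categories manifestly preserves FSM-morphisms and irreducible morphisms", proof of
Thm. 3.4 (ii), p. 63).  This PROOF-ONLY file (no definitions, no instances) adds the converses and the
category-level statements:

* `isFSM_map_equivalence_iff`, `isFSMI_map_equivalence_iff` — `e(β)` is FSM / FSMI iff `β` is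
  (reflection = preservation along `e⁻¹` followed by absorption of the unit isomorphisms:
  `IsFSM.of_isIso` / `IsFSM.comp`, resp. `IsFSMI.iso_comp` / `IsFSMI.comp_iso`, and `NatIso.naturality_2`);
* `IsHeadedFSMIChain.map_equivalence_top` — headed chains (arbitrary head) go to headed chains of
  the same length (the FSMI-chain case `IsFSMIChain.map_equivalence` is abc-iut's
  `EquivalencePreStepsFSMFF2024.lean`, reused by import);
* `isOfFSMFFType_iff_of_equivalence` (2008 (a)+(b)) and `isOfFSMFFType2024_iff_of_equivalence`
  (2008 (a) + 2024 (b)): being of FSMFF-type is invariant under equivalence of categories — condition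
  (a) by factoring `e⁻¹(φ')`, pushing the chain forward and absorbing the counit isomorphisms;
  condition (b) by pulling chains out of `A'` back to chains out of `e⁻¹A'`.

Elementary; nothing here bears on the disputed [IUTchIII] Cor. 3.12 or takes a side; no FACT-LIST row
is asserted (abc-iut cell, seat abc-iut-f-031, by-product; companion of
`CategoryTypesEquivalenceTransport.lean`).
-/

namespace Literature.AlgebraicGeometry.Frobenioids

open CategoryTheory

universe v₁ v₂ u₁ u₂

variable {C : Type u₁} [Category.{v₁} C] {D : Type u₂} [Category.{v₂} D] (e : C ≌ D)

/-! ### FSM- and FSMI-morphisms: reflection -/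

/-- If `e(β)` is an FSM-morphism then so is `β`: `e⁻¹(e(β))` is FSM (`IsFSM.map_equivalence` along
`e⁻¹`), hence so is `unit ≫ e⁻¹(e(β)) ≫ unit⁻¹ = β` (`IsFSM.of_isIso`, `IsFSM.comp`).
[cite: MochizukiFrdI2008, §0 p.14] -/
theorem IsFSM.of_map_equivalence {A B : C} {β : A ⟶ B} (h : IsFSM (e.functor.map β)) : IsFSM β := by
  have hfirst : IsFSM (e.unitIso.hom.app A) := IsFSM.of_isIso _
  have hlast : IsFSM (e.unitIso.inv.app B) := IsFSM.of_isIso _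
  have h₁ : IsFSM (e.unitIso.hom.app A ≫ (e.functor ⋙ e.inverse).map β ≫ e.unitIso.inv.app B) :=
    hfirst.comp ((h.map_equivalence e.symm).comp hlast)
  have key : ∀ {γ : A ⟶ B}, γ = β → IsFSM γ → IsFSM β := fun h₁ h₂ => h₁ ▸ h₂
  exact key (NatIso.naturality_2 e.unitIso β) h₁

/-- `e(β)` is an FSM-morphism iff `β` is. [cite: MochizukiFrdI2008, §0 p.14] -/
theorem isFSM_map_equivalence_iff {A B : C} (β : A ⟶ B) : IsFSM (e.functor.map β) ↔ IsFSM β :=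
  ⟨fun h => h.of_map_equivalence e, fun h => h.map_equivalence e⟩

/-- If `e(β)` is an FSMI-morphism then so is `β`. [cite: MochizukiFrdI2008, §0 p.17] -/
theorem IsFSMI.of_map_equivalence {A B : C} {β : A ⟶ B} (h : IsFSMI (e.functor.map β)) :
    IsFSMI β := by
  have h' := ((h.map_equivalence e.symm).iso_comp (e.unitIso.app A)).comp_iso (e.unitIso.app B).symm
  rw [Category.assoc] at h'
  have key : ∀ {γ : A ⟶ B}, γ = β → IsFSMI γ → IsFSMI β := fun h₁ h₂ => h₁ ▸ h₂
  exact key (NatIso.naturality_2 e.unitIso β) h'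

/-- `e(β)` is an FSMI-morphism iff `β` is. [cite: MochizukiFrdI2008, §0 p.17] -/
theorem isFSMI_map_equivalence_iff {A B : C} (β : A ⟶ B) : IsFSMI (e.functor.map β) ↔ IsFSMI β :=
  ⟨fun h => h.of_map_equivalence e, fun h => h.map_equivalence e⟩

/-! ### Chains of FSMI-morphisms -/

/-- An equivalence carries a headed chain (arbitrary head, FSMI tail) to a headed chain of the same
length. [cite: MochizukiFrdIComments2024, (28) p.3] -/
theorem IsHeadedFSMIChain.map_equivalence_top {A B : C} {φ : A ⟶ B} {n : ℕ}
    (h : IsHeadedFSMIChain ⊤ φ n) : IsHeadedFSMIChain ⊤ (e.functor.map φ) n := by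
  cases h with
  | single φ _ => exact .single _ trivial
  | comp φ₁ χ m _ hχ =>
    rw [Functor.map_comp]
    exact .comp _ _ m trivial (hχ.map_equivalence e)

/-! ### Categories of FSMFF-type (2008) -/

/-- Condition (a) passes along an equivalence: a non-invertible FSM-morphism `φ'` of `D` has
`e⁻¹(φ')` non-invertible FSM, which factors into FSMI-morphisms in `C`; push the chain forward by `e`
and absorb the counit isomorphisms. [cite: MochizukiFrdI2008, §0 p.17] -/
theorem IsFSMIChain.exists_of_equivalence (e : C ≌ D)
    (hfac : ∀ {A B : C} (φ : A ⟶ B), IsFSM φ → ¬ IsIso φ → ∃ n, IsFSMIChain φ n)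
    {A' B' : D} (φ' : A' ⟶ B') (hφ' : IsFSM φ') (hiso : ¬ IsIso φ') : ∃ n, IsFSMIChain φ' n := by
  obtain ⟨n, hn⟩ := hfac (e.inverse.map φ') (hφ'.map_equivalence e.symm)
    fun h => hiso (isIso_of_map_isIso_equivalence e.symm φ' h)
  refine ⟨n, ?_⟩
  have h' := ((hn.map_equivalence e).iso_comp (e.counitIso.app A').symm).comp_iso (e.counitIso.app B')
  rw [Category.assoc] at h'
  have key : ∀ {γ : A' ⟶ B'}, γ = φ' → IsFSMIChain γ n → IsFSMIChain φ' n := fun h₁ h₂ => h₁ ▸ h₂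
  exact key (NatIso.naturality_1 e.counitIso φ') h'

/-- A category equivalent to one of FSMFF-type (2008 printed conditions (a), (b)) is of FSMFF-type.
[cite: MochizukiFrdI2008, §0 p.17] -/
theorem IsOfFSMFFType.of_equivalence (e : C ≌ D) (h : IsOfFSMFFType C) : IsOfFSMFFType D where
  factors φ' hφ' hiso := IsFSMIChain.exists_of_equivalence e h.factors φ' hφ' hiso
  bounded A' := by
    obtain ⟨N, hN⟩ := h.bounded (e.inverse.obj A')
    exact ⟨N, fun φ' n hφ' => hN _ n (hφ'.map_equivalence e.symm)⟩

/-- Being of FSMFF-type (2008) is invariant under equivalence of categories.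
[cite: MochizukiFrdI2008, §0 p.17] -/
theorem isOfFSMFFType_iff_of_equivalence (e : C ≌ D) : IsOfFSMFFType C ↔ IsOfFSMFFType D :=
  ⟨fun h => h.of_equivalence e, fun h => h.of_equivalence e.symm⟩

/-! ### Categories of FSMFF-type (2024 revision of condition (b)) -/

/-- A category equivalent to one of FSMFF-type in the 2024 sense is of FSMFF-type in the 2024 sense.
[cite: MochizukiFrdIComments2024, (28) p.3] -/
theorem IsOfFSMFFType2024.of_equivalence (e : C ≌ D) (h : IsOfFSMFFType2024 C) :
    IsOfFSMFFType2024 D where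
  factors φ' hφ' hiso := IsFSMIChain.exists_of_equivalence e h.factors φ' hφ' hiso
  bounded A' := by
    obtain ⟨N, hN⟩ := h.bounded (e.inverse.obj A')
    exact ⟨N, fun φ' n hφ' => hN _ n (hφ'.map_equivalence_top e.symm)⟩

/-- Being of FSMFF-type (2024) is invariant under equivalence of categories.
[cite: MochizukiFrdIComments2024, (28) p.3] -/
theorem isOfFSMFFType2024_iff_of_equivalence (e : C ≌ D) :
    IsOfFSMFFType2024 C ↔ IsOfFSMFFType2024 D :=
  ⟨fun h => h.of_equivalence e, fun h => h.of_equivalence e.symm⟩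

end Literature.AlgebraicGeometry.Frobenioids
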